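import Summits.BirchSwinnertonDyer.BirchSwinnertonDyer.Theorems.KimAtThreeDeepUpperWitnessPair
import Summits.BirchSwinnertonDyer.Rank1Residual.GaloisImage.KatoKuriharaPortThreeOfZetaBodyOfValueRows
import HarnessLib

/-!
# ★ PK-6₂-u — PORT″ `KatoKuriharaPortThreeAtWith₂ W 0 v₃ η P` FROM KATO'S EULER SYSTEM WITHOUT the
# row certificate `hbad`: rows WITH a `3`-anomalous bad place INCLUDED (cell `bsd-addord`, seat w2-c3
# gen 5; route W2 `KimAtThreeKolyvagin`, crux 19076 `DeepUpperAtThree`, §U child 19560, residual (C3))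

HONEST FRAMING: END theorems with DISPLAYED hypotheses (no definition, no named fact, no `sorry`);
close nothing by themselves; nothing is booked; BSD is not proved by any of this.

## What

n1011-p13's ★ PK-6₂ `katoKuriharaPortThreeAtWith₂_zero_of_zetaBody`
(`GaloisImage/KatoKuriharaPortThreeOfZetaBody`) derives PORT″ at a `t = 0` row from Kato's matrix
`ZetaBody` (hbody), the (P-EXP) riders `hfin`, the auxiliary-datum guard `hcdA`, the value rows
`hvalue`, and THEOREM D's TWO row certificates `ht0` (no `3`-torsion over `ℚ₃`) and `hbad` (none over
`ℚ_w` at any bad `w ≠ 3`).  **`katoKuriharaPortThreeAtWith₂_zero_of_zetaBody_of_unramified`** is the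
same END with `hbad` DELETED — THEOREM D is replaced by the seat's THEOREM D-u chain
(`KimAtThreeDeepUpperBadPlaceDescent` = n1011-p15's T-DER-BU U5, `…BadPlaceCondition`,
`…BadPlaceClause`, `…KolyvaginPair`, `…WitnessPair`), whose extra input (every Kato class unramified
away from `3` at class level) is conjunct (C2) of `ZetaBody` itself.  So on the Kato stratum the rows
WITH a `3`-anomalous bad place (79.4 %, kim3 census j255378) are no longer excluded.
`…_of_valueRows_of_unramified` is n1011-p02's T-PK6-VDIS composition (value rows discharged from the
level-free certificates) on top of it, again without `hbad`.

HONEST LIMITS: `t = 0` only (the place `3` stays `ht0`); the value certificates and the riders stay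
displayed; nothing is booked; no PORT predicate is defined here.

References: K. Kato, Astérisque 295 (2004) (8.1.3), §9.4, Thm. 9.7, Thm. 6.6 (1), Ex. 13.3; C.-H. Kim,
arXiv:2203.12159 Thm. 3.13; B. Mazur, K. Rubin, Mem. AMS 799 (2004) Thm. 3.2.4, App. A Remark A.5;
K. Rubin, *Euler Systems* (2000) Thm. 4.5.1; R. Sakamoto, JTNB 36 (2024) Def. 4.1.
-/

noncomputable section

-- the cell's Theorems namespace `Summit.BirchSwinnertonDyer.BirchSwinnertonDyer.…` repeats the summit name by design (D-0017)
set_option linter.dupNamespace false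

open scoped NumberField TensorProduct ContRepresentation Classical
open CategoryTheory Field Function Finset IsDedekindDomain NumberField WeierstrassCurve
open Rat.HeightOneSpectrum
open Literature.NumberTheory.GaloisRepresentations Literature.NumberTheory.GaloisCohomology
open Literature.NumberTheory.GaloisRepresentations.DiscreteGaloisModule
open Literature.NumberTheory.EllipticCurves Literature.NumberTheory.EllipticCurves.ModularForms
open Literature.NumberTheory.EllipticCurves.Kato2004
open Literature.NumberTheory.EllipticCurves.Kato2004.EulerSystemValues
open Summit.BirchSwinnertonDyer.Rank1Residual.GaloisImage
open Summit.BirchSwinnertonDyer.BirchSwinnertonDyer.Theorems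

namespace Summit.BirchSwinnertonDyer.BirchSwinnertonDyer.Theorems.KimAtThreeDeepUpperPortOfZetaBody

variable (W : WeierstrassCurve ℚ) [W.IsElliptic] [W.IsGloballyMinimal]
  [ContinuousSMul ℤ_[3] (W.tateModule 3)] [Module.Free ℤ_[3] (W.tateModule 3)]
  [Module.Finite ℤ_[3] (W.tateModule 3)]

/-- Local notation: `𝐃F⟦r, τ⟧ ℓ = Σ_{j<ℓ−1} j·σ_{χ_{m(0,r)}(τ_ℓ)}^j` on the level field `ℚ(ζ_{m(0,r)})`
(PK-1 ★2's field-side spelling, `p = 3`). -/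
local notation3 (prettyPrint := false) "𝐃F⟦" r ", " τ "⟧" =>
  fun ℓ : HeightOneSpectrum (𝓞 ℚ) =>
  ∑ j ∈ Finset.range (((primesEquiv ℓ : Nat.Primes) : ℕ) - 1),
    (j : Module.End ℚ (CyclotomicField (cycLevel 3 0 r) ℚ)) *
      (sigma (cycLevel 3 0 r) (modNCyclotomicCharacter ℚ (cycLevel 3 0 r)
          ((τ : HeightOneSpectrum (𝓞 ℚ) → absoluteGaloisGroup ℚ) ℓ)) :
        CyclotomicField (cycLevel 3 0 r) ℚ →ₐ[ℚ] CyclotomicField (cycLevel 3 0 r) ℚ).toLinearMap ^ j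

set_option backward.isDefEq.respectTransparency false in
/-- **★ PK-6₂-u: PORT″ at `t = 0` from Kato's Euler system, THEOREM D-u, the riders and the value
rows — NO `hbad`** (module docstring): ★ PK-6₂'s binders minus `hbad`; concluded
`KatoKuriharaPortThreeAtWith₂ W 0 v₃ η P` for every place `v₃` and every generator family `η`.
[cite: Kato2004Asterisque, (8.1.3) (p. 180), §9.4 (p. 188), Thm. 9.7 (p. 189) and Ex. 13.3 (pp. 224–225)]
[cite: Kim2022StructureSelmer, Thm. 3.13 and §1.2.2, §2.2.2, §3.3–§3.4.1 (arXiv v3 pp. 12, 17–18, 26–27)]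
[cite: MazurRubin2004, Def. 3.1.3, Thm. 3.2.4 and App. A (Lemma A.1, Remark A.5)] [cite: Sakamoto2024, §2 and Def. 4.1] -/
theorem katoKuriharaPortThreeAtWith₂_zero_of_zetaBody_of_unramified
    {N : ℕ} [NeZero N] (P : ModularParametrizationData W N) (hN : N = W.conductorNorm ℤ)
    {ι : (n : ℕ) → (CyclotomicField n ℚ →+* ℂ)} {κK : ℝ}
    {Λ : ∀ (k' : ℕ) (r : Finset (HeightOneSpectrum (𝓞 ℚ))),
      H1 (tateRep W 3) (cycSubgroup 3 k' r) →ₗ[ℤ_[3]] ℚ_[3] ⊗[ℚ] CyclotomicField (cycLevel 3 k' r) ℚ}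
    {c d a : ℤ} {A : ℕ}
    {z : ∀ (k' : ℕ) (r : (cyclotomicLevelsRat 3 (badPlaces c d A N)).Ideals),
      H1 (tateRep W 3) ((cyclotomicLevelsRat 3 (badPlaces c d A N)).level k' r.1)}
    {x : ∀ (k' : ℕ) (r : (cyclotomicLevelsRat 3 (badPlaces c d A N)).Ideals),
      CyclotomicField (cycLevel 3 k' r.1) ℚ}
    (hbody : ZetaBody W 3 P.f ι κK Λ c d a A z x)
    {v₃ : HeightOneSpectrum (𝓞 ℚ)}
    (Λfin : ∀ j : ℕ, galoisCohomology ((W.torsionGaloisModule (((3 : ℕ) : ℤ) ^ j * ((3 : ℕ) : ℤ))).toLocal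
      (Sum.inr v₃)) 1 →+ ZMod (3 ^ (j + 1)))
    (hfin : ∀ j : ℕ, KatoExpStarFiniteLevelAt W 3 j 0 v₃ Λ (Λfin j))
    {η : (q : HeightOneSpectrum (𝓞 ℚ)) → (ZMod (Ideal.absNorm q.asIdeal))ˣ}
    -- the auxiliary datum avoids every prime `≡ 1 (mod 3)` (so every Kolyvagin prime is usable)
    (hcdA : ∀ q : ℕ, q.Prime → q ≡ 1 [MOD 3] → ¬ q ∣ 2 * c.natAbs * d.natAbs * A)
    -- THEOREM D-u's row certificate at `3` only (`t = 0`); NO `hbad`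
    (ht0 : ∀ w : HeightOneSpectrum (𝓞 ℚ), ((3 : ℕ) : 𝓞 ℚ) ∈ w.asIdeal →
        ∀ Q : (W.baseChange (w.adicCompletion ℚ)).toAffine.Point, 3 • Q = 0 → Q = 0)
    -- the per-level VALUE ROWS (T-PK6-VROW's OUT), displayed
    (hvalue : ∀ (j : ℕ) (σ : HeightOneSpectrum (𝓞 ℚ) → absoluteGaloisGroup ℚ),
      (∀ q, σ q ∈ (adicCompletionPrime ℚ q).inertia (absoluteGaloisGroup ℚ)) →
      (∀ q, modNCyclotomicCharacter ℚ (Ideal.absNorm q.asIdeal) (σ q) = η q) →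
      ∀ (r : Finset (HeightOneSpectrum (𝓞 ℚ)))
        (hr : ∀ q ∈ r, q ∈ (cyclotomicLevelsRat 3 (badPlaces c d A N)).primes),
        (∀ q ∈ r, Kato.IsKolyvaginPrime W 3 (j + 1) ((primesEquiv q : Nat.Primes) : ℕ)) →
        (∀ q ∈ r, Subgroup.zpowers (η q) = ⊤) →
        ∃ (s : ℤ_[3]) (u : (ZMod (3 ^ (j + 1)))ˣ)
          (ψ : (ℓ : ℕ) → (ZMod ℓ)ˣ →* Multiplicative (ZMod (3 ^ (j + 1)))),
          (∀ q ∈ r, Function.Surjective (ψ (Ideal.absNorm q.asIdeal))) ∧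
          (∃ l ∈ cycIntLattice 3 (cycLevel 3 0 r),
            (((3 : ℕ) : ℤ_[3]) ^ (0 : ℕ)) • ((1 : ℚ_[3]) ⊗ₜ[ℚ]
              ((r.noncommProd 𝐃F⟦r, σ⟧ (ZetaValue.pairwise_commute_fieldDeriv (cycLevel 3 0 r)
                  (fun ℓ => modNCyclotomicCharacter ℚ (cycLevel 3 0 r) (σ ℓ))
                  (fun ℓ => ((primesEquiv ℓ : Nat.Primes) : ℕ) - 1) r))
                (x 0 ⟨r, hr⟩ + sigma (cycLevel 3 0 r) (-1) (x 0 ⟨r, hr⟩)))) -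
              ((s : ℚ_[3]) ⊗ₜ[ℚ] (1 : CyclotomicField (cycLevel 3 0 r) ℚ)) =
            (((3 : ℕ) : ℤ_[3]) ^ (j + 1)) • (l : ℚ_[3] ⊗[ℚ] CyclotomicField (cycLevel 3 0 r) ℚ)) ∧
          haveI : NeZero (∏ q ∈ r, Ideal.absNorm q.asIdeal) :=
            ⟨Finset.prod_ne_zero_iff.2 fun q _ h => q.ne_bot (Ideal.absNorm_eq_zero_iff.1 h)⟩
          PadicInt.toZModPow (j + 1) s = (u : ZMod (3 ^ (j + 1))) *
            ((3 : ℕ) : ZMod (3 ^ (j + 1))) ^ (0 : ℕ) *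
              kuriharaNumber P.f (3 ^ (j + 1)) (∏ q ∈ r, Ideal.absNorm q.asIdeal) ψ) :
    KatoKuriharaPortThreeAtWith₂ W 0 v₃ η P := by
  intro k k' D D' red hDW hDW' hkk' hred _hadd _hc3 hsurj _ht hv₃ _hcP _hper
  -- the guards
  obtain ⟨hT, hC, S, τ, hS, hτμ, hτq, hP⟩ := hDW
  obtain ⟨hT', hC', S', τ', hS', hτμ', hτq', hP'⟩ := hDW'
  have hirr : W.HasIrreducibleModPGaloisRep 3 :=
    hasIrreducibleModPGaloisRep_of_hasSurjectiveModNGaloisRep W 3 hsurj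
  -- Kolyvagin primes of the right levels (E1-deep on the deep classes of the guards)
  have hKol : ∀ q ∈ D.primes, Kato.IsKolyvaginPrime W 3 (k + 1) ((primesEquiv q : Nat.Primes) : ℕ) :=
    fun q hq => KolyvaginPrime.isKolyvaginPrime_of_mem_frobeniusClassPrimes_of_le W
      (Nat.le_add_right k 0) (fun v hv => (hS v hv).1) hτμ hτq (hP hq)
  have hKol' : ∀ q ∈ D'.primes, Kato.IsKolyvaginPrime W 3 (k' + 1) ((primesEquiv q : Nat.Primes) : ℕ) :=
    fun q hq => KolyvaginPrime.isKolyvaginPrime_of_mem_frobeniusClassPrimes_of_le W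
      (Nat.le_add_right k' 0) (fun v hv => (hS' v hv).1) hτμ' hτq' (hP' hq)
  -- every Kolyvagin prime is a usable prime of Kato's system for `(c, d, A, N)`
  have husable : ∀ (j : ℕ) (q : HeightOneSpectrum (𝓞 ℚ)),
      Kato.IsKolyvaginPrime W 3 (j + 1) ((primesEquiv q : Nat.Primes) : ℕ) →
        q ∈ (cyclotomicLevelsRat 3 (badPlaces c d A N)).primes := by
    intro j q hq
    have hℓ := hq.prime
    have h13 : ((primesEquiv q : Nat.Primes) : ℕ) ≡ 1 [MOD 3] :=
      hq.modEq_one.of_dvd (dvd_pow_self 3 (Nat.succ_ne_zero j))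
    refine (mem_primes_cyclotomicLevelsRat_badPlaces_iff 3 c d A N q).2 ⟨fun hdvd => ?_, hq.ne⟩
    rcases (Nat.Prime.dvd_mul hℓ).mp hdvd with h | h
    · exact hcdA _ hℓ h13 h
    · apply hq.not_dvd
      rw [← hN]
      exact dvd_mul_of_dvd_left h 3
  have hPr : D.primes ⊆ (cyclotomicLevelsRat 3 (badPlaces c d A N)).primes :=
    fun q hq => husable k q (hKol q hq)
  have hPr' : D'.primes ⊆ (cyclotomicLevelsRat 3 (badPlaces c d A N)).primes :=
    fun q hq => husable k' q (hKol' q hq)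
  -- `𝓕_can,3 = ⊤` at every depth (`t = 0`, Mazur–Rubin Lemma A.1 along the reduction tower)
  have htower : ∀ j : ℕ,
      ∃ redj : (W.torsionGaloisModule (((3 : ℕ) : ℤ) ^ (j + 1) * ((3 : ℕ) : ℤ))).toContRepresentation →ⁱL
          (W.torsionGaloisModule (((3 : ℕ) : ℤ) ^ j * ((3 : ℕ) : ℤ))).toContRepresentation,
        ∀ y : geomTorsion W (((3 : ℕ) : ℤ) ^ (j + 1) * ((3 : ℕ) : ℤ)),
          ((redj y : geomTorsion W (((3 : ℕ) : ℤ) ^ j * ((3 : ℕ) : ℤ))) : geomPoints W) =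
            ((3 : ℕ) : ℤ) • (y : geomPoints W) := by
    intro j
    obtain ⟨redj, hredj⟩ := exists_torsionReduction_three W j (j + 1)
    refine ⟨redj, fun y => ?_⟩
    rw [hredj, Nat.add_sub_cancel_left, pow_one]
  choose redT hredT using htower
  have htop : ∀ (j : ℕ) (w : HeightOneSpectrum (𝓞 ℚ)), ((primesEquiv w : Nat.Primes) : ℕ) = 3 →
      propagatedSelmerStructure W 3 j (Sum.inr w) = ⊤ := by
    intro j w hw
    have hw3 : ((3 : ℕ) : 𝓞 ℚ) ∈ w.asIdeal := KolyvaginPrime.natCast_mem_asIdeal_of_primesEquiv_eq hw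
    exact propagatedSelmerStructure_three_eq_top_of_torsion_eq_zero W w hw3 (ht0 w hw3) redT hredT j
  -- the witness package at the two depths + (COMP) WITHOUT `hbad` (the seat's T-PK62-PAIR-u on
  -- THEOREM D-u), value rows from `hvalue`
  obtain ⟨κf, κu, h₁, h₂, h₃⟩ :=
    KimAtThreeDeepUpperWitnessPair.exists_katoKuriharaWitnessAt_pair_of_zetaBody_of_unramified W P hbody
      hirr hkk' red hred hv₃ (hfin k) (hfin k') D hT D' hT' hC hC' hPr hPr' hKol hKol' (htop k) (htop k')
      (fun σ hI hχ r hr => hvalue k σ hI hχ r (fun q hq => hPr (hr (Finset.mem_coe.2 hq)))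
        (fun q hq => hKol q (hr (Finset.mem_coe.2 hq)))
        (fun q hq => hC.zpowers_eq_top (hr (Finset.mem_coe.2 hq))))
      (fun σ hI hχ r hr => hvalue k' σ hI hχ r (fun q hq => hPr' (hr (Finset.mem_coe.2 hq)))
        (fun q hq => hKol' q (hr (Finset.mem_coe.2 hq)))
        (fun q hq => hC'.zpowers_eq_top (hr (Finset.mem_coe.2 hq))))
  exact ⟨κf, Λfin k, κf, κu, Λfin k', κu, h₁, h₂, fun e he' he => ⟨h₃ e he' he, h₃ e he' he⟩⟩


/-- **★ PK-6₂-u with the value rows discharged** (n1011-p02's T-PK6-VDIS composition without `hbad`):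
PORT″ `KatoKuriharaPortThreeAtWith₂ W 0 v₃ η P` from `ZetaBody`, the riders `hfin`, `hcdA`, THEOREM
D-u's certificate `ht0`, and the level-free VALUE certificates (`hirr`, `hNorm`/`hκ0`, `d′`/`hcd`/`hdd′`,
`hAN`, `hpN`, `aM`/`haM`, `hE0`/`hE`, `hR0`/`hR`).
[cite: Kato2004Asterisque, §9.4 (p. 188), Thm. 9.7 (p. 189), Thm. 6.6 (1) (p. 163) and Ex. 13.3 (pp. 224–225)]
[cite: Kim2022StructureSelmer, Thm. 3.13 and its proof (arXiv v3 pp. 12, 26–28)] -/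
theorem katoKuriharaPortThreeAtWith₂_zero_of_zetaBody_of_valueRows_of_unramified
    {N : ℕ} [NeZero N] (P : ModularParametrizationData W N) (hN : N = W.conductorNorm ℤ)
    {ι : (n : ℕ) → (CyclotomicField n ℚ →+* ℂ)} {κK : ℝ}
    {Λ : ∀ (k' : ℕ) (r : Finset (HeightOneSpectrum (𝓞 ℚ))),
      H1 (tateRep W 3) (cycSubgroup 3 k' r) →ₗ[ℤ_[3]] ℚ_[3] ⊗[ℚ] CyclotomicField (cycLevel 3 k' r) ℚ}
    {c d a : ℤ} {A : ℕ} [NeZero A]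
    {z : ∀ (k' : ℕ) (r : (cyclotomicLevelsRat 3 (badPlaces c d A N)).Ideals),
      H1 (tateRep W 3) ((cyclotomicLevelsRat 3 (badPlaces c d A N)).level k' r.1)}
    {x : ∀ (k' : ℕ) (r : (cyclotomicLevelsRat 3 (badPlaces c d A N)).Ideals),
      CyclotomicField (cycLevel 3 k' r.1) ℚ}
    (hbody : ZetaBody W 3 P.f ι κK Λ c d a A z x)
    {v₃ : HeightOneSpectrum (𝓞 ℚ)}
    (Λfin : ∀ j : ℕ, galoisCohomology ((W.torsionGaloisModule (((3 : ℕ) : ℤ) ^ j * ((3 : ℕ) : ℤ))).toLocal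
      (Sum.inr v₃)) 1 →+ ZMod (3 ^ (j + 1)))
    (hfin : ∀ j : ℕ, KatoExpStarFiniteLevelAt W 3 j 0 v₃ Λ (Λfin j))
    {η : (q : HeightOneSpectrum (𝓞 ℚ)) → (ZMod (Ideal.absNorm q.asIdeal))ˣ}
    (hcdA : ∀ q : ℕ, q.Prime → q ≡ 1 [MOD 3] → ¬ q ∣ 2 * c.natAbs * d.natAbs * A)
    (ht0 : ∀ w : HeightOneSpectrum (𝓞 ℚ), ((3 : ℕ) : 𝓞 ℚ) ∈ w.asIdeal →
        ∀ Q : (W.baseChange (w.adicCompletion ℚ)).toAffine.Point, 3 • Q = 0 → Q = 0)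
    -- the VALUE certificates (T-PK6-VDIS), replacing ★ PK-6₂'s displayed `hvalue`
    (hirr : W.HasIrreducibleModPGaloisRep 3)
    (hNorm : ∃ u : ℚ, (u : ℝ) = κK ∧ padicValRat 3 u = 0) (hκ0 : κK ≠ 0)
    (d' : ℤ) (hcd : Int.gcd (c * d) A = 1) (hdd' : d * d' ≡ 1 [ZMOD (A : ℤ)])
    (hAN : Nat.Coprime A N) (hpN : 3 ^ 2 ∣ N)
    (aM : ℕ → ℤ) (haM : ∀ q ∈ (3 * A).primeFactors, cuspCoeff P.f q = aM q)
    (hE0 : ∏ q ∈ (3 * A).primeFactors, (1 - (aM q : ℚ) / q + (if q ∣ N then 0 else (1 / q : ℚ))) ≠ 0)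
    (hE : padicValRat 3
      (∏ q ∈ (3 * A).primeFactors, (1 - (aM q : ℚ) / q + (if q ∣ N then 0 else (1 / q : ℚ)))) = 0)
    (hR0 : (c : ℚ) ^ 2 * (d : ℚ) ^ 2 * ratMinusSymbol P.f ((a : ℚ) / A) -
        (c : ℚ) * (d : ℚ) ^ 2 * ratMinusSymbol P.f ((a * c : ℚ) / A) -
        (c : ℚ) ^ 2 * (d : ℚ) * ratMinusSymbol P.f ((a * d' : ℚ) / A) +
        (c : ℚ) * (d : ℚ) * ratMinusSymbol P.f ((a * c * d' : ℚ) / A) ≠ 0)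
    (hR : padicValRat 3 ((c : ℚ) ^ 2 * (d : ℚ) ^ 2 * ratMinusSymbol P.f ((a : ℚ) / A) -
        (c : ℚ) * (d : ℚ) ^ 2 * ratMinusSymbol P.f ((a * c : ℚ) / A) -
        (c : ℚ) ^ 2 * (d : ℚ) * ratMinusSymbol P.f ((a * d' : ℚ) / A) +
        (c : ℚ) * (d : ℚ) * ratMinusSymbol P.f ((a * c * d' : ℚ) / A)) = 0) :
    KatoKuriharaPortThreeAtWith₂ W 0 v₃ η P :=
  katoKuriharaPortThreeAtWith₂_zero_of_zetaBody_of_unramified W P hN hbody Λfin hfin hcdA ht0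
    (ValueRow.valueRows_of_zetaBody hbody P.isNewformOf (by decide) hirr hNorm hκ0 d' hcd hdd' hAN hpN
      aM haM hE0 hE hR0 hR η)


end Summit.BirchSwinnertonDyer.BirchSwinnertonDyer.Theorems.KimAtThreeDeepUpperPortOfZetaBody

end
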